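import Literature.AlgebraicGeometry.HodgeTheory.WeilSurfaceCMSquare
import Literature.AlgebraicGeometry.Motives.RationalDegreeOneModel
import Literature.AlgebraicGeometry.Motives.RationalDegreeOneModelWeilType
import HarnessLib

/-!
# The rational degree-one model of the CM curve `(E₀, ± ψ₀)` in the frame `(v, ψ₀^* v)`

Family `hodge`, layer `Literature/AlgebraicGeometry/HodgeTheory`. Companion of `WeilSurfaceCMSquare`
(the CM square `E₀ × E₀` with `(ψ₀, -ψ₀)` is a Weil-type surface) and of
`Motives/RationalDegreeOneModel` (rational degree-one models `(u, M, ω, G, d)` of triples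
`(A, φ, h)` exist), serving the final assembly of the partner-surface lemma
`exists_weilTypeSurface_prod_isHyperbolicWeilType_all` (Markman, arXiv:2509.23403 §11.5 Step 2;
van Geemen, LNM 1594, Lemma 5.2 (2)–(3), 5.3; Schoen 1998 §10), whose aiming arithmetic
(`Motives/WeilFormIsotropicBlockVectors`, `exists_isotropic_blockVectors`) consumes the binary
partner in the EXPLICIT shape `(M_E, G_E; ± M_E)`. For a complex abelian variety `E₀` of dimension
`1` with `ψ₀ ≫ ψ₀ = -(d • 𝟙)`, `d ≥ 1`, this file PROVES (`cmCurve_rationalModel`) that in the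
rational basis `u = (v, ψ₀^* v)` of `H¹(E₀(ℂ); ℂ)` (`v ≠ 0` any rational class;
`linearIndependent_pair_map_one`):

* `ψ₀^*` has the companion matrix `M_E = ((0, -d), (1, 0))` and `(-ψ₀)^*` the matrix `-M_E`
  (`(ψ₀^*)² = -d`, additivity of `f ↦ f^*|_{H¹}`);
* the cup product has Gram matrix `G_E = ((0, 1), (-1, 0))` with respect to the rational top class
  `ω_E = v ∪ ψ₀^* v ≠ 0` (alternation in degree one; `cupProduct_map_one_ne_zero`), i.e. the
  polarization pairing `Q_{h, 0}(x, y) = x ∪ y` of `Motives/HyperbolicWeilType` has Gram matrix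
  `G_E` for EVERY class `h`;
* every rational `h ∈ H²(E₀(ℂ); ℂ)` is `t · ω_E` with `t ∈ ℚ` (`b₂ = 1`), which is its "top power"
  `L⁰_h h = h`;
* `ψ₀^*` and `(-ψ₀)^*` act on `H²(E₀(ℂ); ℂ)` as the scalar `d` (`map_top_eq_pow_smul`: the
  determinant of `± ψ₀^*|_{H¹}`), so that the `K`-symmetrised class of any `H` is
  `d·H + (±ψ₀)^* H = 2d·H`.

Everything is proved; no definition and no named fact is introduced (D-0026).

## References

* [vanGeemen1994HodgeAV] B. van Geemen, An introduction to the Hodge conjecture for abelian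
  varieties, LNM 1594 (1994), 4.9, Lemma 5.2 (2), 5.3.
* [Schoen1998HodgeWeilAddendum] C. Schoen, Compositio Math. 114 (1998), §10.
* [LangeBirkenhake1992] H. Lange, Ch. Birkenhake, Complex Abelian Varieties (1992), Lemma 1.1.17,
  Prop. 1.1.9.
-/

noncomputable section

open CategoryTheory

namespace Literature.AlgebraicGeometry.HodgeTheory

open Literature.AlgebraicTopology.SingularHomology
open Literature.AlgebraicGeometry.Motives
open Literature.Geometry.Kaehler

variable {E₀ : Motives.AbelianVariety ℂ} {d : ℕ} {ψ₀ : E₀ ⟶ E₀}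

/-- `± ψ₀` acts on the line `H²(E₀(ℂ); ℂ)` (`dim E₀ = 1`) as the scalar `d` when `ψ₀ ≫ ψ₀ = -d`:
the determinant of `± ψ₀^*` on `H¹` is `d` (`map_top_eq_pow_smul`). [cite: vanGeemen1994HodgeAV, Lemma 5.2 (2)] -/
theorem cmCurve_map_two (hE : E₀.dim = 1) (hd : 0 < d) {φ : E₀ ⟶ E₀} (hφ : φ ≫ φ = -(d • 𝟙 E₀))
    (x : complexBetti E₀.X (2 + 2 * 0)) :
    complexBetti.map φ.hom.hom.hom (2 + 2 * 0) x = (d : ℂ) • x := by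
  have h := map_top_eq_pow_smul (j := 0) hE (surface_finrank_complexBetti_one E₀)
    ((surface_hasExteriorCohomologyH1 E₀).span_range_cupPowOne (2 + 2 * 0)) hd hφ x
  rw [h, zero_add, pow_one]

/-- **The rational degree-one model of the CM curve in the frame `(v, ψ₀^* v)`.** For `E₀` of
dimension `1`, `ψ₀ ≫ ψ₀ = -(d • 𝟙)`, `d ≥ 1`: a rational basis `u = (u₀, u₁) = (v, ψ₀^* v)` of
`H¹(E₀(ℂ); ℂ)` in which `ψ₀^*` has matrix `M_E = ((0, -d), (1, 0))` (`ψ₀^* uᵢ = Σ_k (M_E)_{ki} u_k`)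
and `(-ψ₀)^*` has matrix `-M_E`; a rational top class `ω = v ∪ ψ₀^* v ≠ 0` with respect to which
the polarization pairing `Q_{h,0}(uᵢ, u_k) = uᵢ ∪ u_k` has Gram matrix `G_E = ((0, 1), (-1, 0))` for
every `h`; every rational `h ∈ H²` has `L⁰_h h = h = t·ω`, `t ∈ ℚ`; and `(± ψ₀)^* = d` on `H²`.
[cite: vanGeemen1994HodgeAV, 4.9 and Lemma 5.2 (2)] [cite: LangeBirkenhake1992, Lemma 1.1.17] -/
theorem cmCurve_rationalModel (hE : E₀.dim = 1) (hd : 0 < d) (hψ : ψ₀ ≫ ψ₀ = -(d • 𝟙 E₀)) :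
    ∃ (u : Fin 2 → complexBetti E₀.X 1) (ω : complexBetti E₀.X (2 + 2 * 0)),
      (∀ i, IsRationalClass (u i)) ∧ LinearIndependent ℂ u ∧ Submodule.span ℂ (Set.range u) = ⊤ ∧
      (∀ i, complexBetti.map ψ₀.hom.hom.hom 1 (u i) =
        ∑ k, ((!![(0 : ℚ), -(d : ℚ); 1, 0] k i : ℚ) : ℂ) • u k) ∧
      (∀ i, complexBetti.map (-ψ₀).hom.hom.hom 1 (u i) =
        ∑ k, (((-!![(0 : ℚ), -(d : ℚ); 1, 0]) k i : ℚ) : ℂ) • u k) ∧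
      IsRationalClass ω ∧ ω ≠ 0 ∧
      (∀ (h : complexBetti E₀.X 2) (i k : Fin 2),
        Motives.polarizationPairingOne E₀.X h 0 (u i) (u k) = ((!![(0 : ℚ), 1; -1, 0] i k : ℚ) : ℂ) • ω) ∧
      (∀ h : complexBetti E₀.X 2, IsRationalClass h →
        ∃ t : ℚ, lefschetzPow h 0 2 h = ((t : ℚ) : ℂ) • ω) ∧
      (∀ x : complexBetti E₀.X (2 + 2 * 0), complexBetti.map ψ₀.hom.hom.hom (2 + 2 * 0) x = (d : ℂ) • x) ∧
      (∀ x : complexBetti E₀.X (2 + 2 * 0),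
        complexBetti.map (-ψ₀).hom.hom.hom (2 + 2 * 0) x = (d : ℂ) • x) := by
  classical
  have hX : Motives.IsSmoothProjective (0 + 1) E₀.X := isSmoothProjective_of_dim_eq' hE
  set T := (complexBetti.map ψ₀.hom.hom.hom 1).hom with hTdef
  have hT2 : ∀ c, T (T c) = -((d : ℂ) • c) := fun c ↦ complexBetti_map_map_one_of_comp_self hψ c
  obtain ⟨v, hv, hv0⟩ := exists_isRationalClass_ne_zero_one hE
  have hTv : IsRationalClass (T v) := hv.map _
  have hli : LinearIndependent ℂ ![v, T v] := linearIndependent_pair_map_one hd hψ hv hv0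
  haveI : Module.Finite ℂ (complexBetti E₀.X 1) := finite_complexBetti_abelianVariety E₀ 1
  have hcard : Fintype.card (Fin 2) = Module.finrank ℂ (complexBetti E₀.X 1) := by
    rw [Fintype.card_fin, finrank_complexBetti_one_of_dim_eq_one hE]
  -- the frame, the top class
  set u : Fin 2 → complexBetti E₀.X 1 := ![v, T v] with hu
  set ω : complexBetti E₀.X (2 + 2 * 0) := cupProduct (rfl : 1 + 1 = 2) v (T v) with hω
  have hω0 : ω ≠ 0 := cupProduct_map_one_ne_zero hE hd hψ hv hv0
  have hωrat : IsRationalClass ω := hv.cup _ hTv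
  have hvv : cupProduct (rfl : 1 + 1 = 2) v v = 0 := cup_self_deg_one v
  have htt : cupProduct (rfl : 1 + 1 = 2) (T v) (T v) = 0 := cup_self_deg_one (T v)
  have htv : cupProduct (rfl : 1 + 1 = 2) (T v) v = -cupProduct (rfl : 1 + 1 = 2) v (T v) := by
    have h := cupProduct_gradedComm_holds ℂ (Motives.ComplexPoints E₀.X) (rfl : 1 + 1 = 2) rfl (T v) v
    simpa using h
  have hψ' : (-ψ₀) ≫ (-ψ₀) = -(d • 𝟙 E₀) := by rw [Preadditive.neg_comp_neg, hψ]
  refine ⟨u, ω, ?_, hli, ?_, ?_, ?_, hωrat, hω0, ?_, ?_, cmCurve_map_two hE hd hψ,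
    cmCurve_map_two hE hd hψ'⟩
  · intro i
    fin_cases i
    · exact hv
    · exact hTv
  · exact (basisOfLinearIndependentOfCardEqFinrank hli hcard).span_eq.symm ▸
      (by rw [coe_basisOfLinearIndependentOfCardEqFinrank])
  · intro i
    fin_cases i
    · -- `ψ₀^* v = T v = 0 • v + 1 • T v`
      simp [hu, Fin.sum_univ_two]
      rfl
    · -- `ψ₀^* (T v) = -d v`
      simp [hu, Fin.sum_univ_two]
      exact hT2 v
  · intro i
    have hneg : ∀ c, complexBetti.map (-ψ₀).hom.hom.hom 1 c = -(T c) := fun c ↦ by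
      rw [complexBetti_map_neg_one]; rfl
    fin_cases i
    · simp [hu, Fin.sum_univ_two, hneg]
    · simp [hu, Fin.sum_univ_two, hneg]
      rw [hT2, neg_neg]
  · intro h i k
    rw [Motives.polarizationPairingOne_apply]
    change cupProduct (rfl : 1 + 1 = 2) (u i) (u k) = _
    fin_cases i <;> fin_cases k
    · simpa [hu] using hvv
    · simp [hu, hω]
    · simpa [hu, hω] using htv
    · simpa [hu] using htt
  · intro h hh
    have h1 : Module.finrank ℂ (complexBetti E₀.X (2 + 2 * 0)) = 1 :=
      finrank_complexBetti_two_add_two_mul_eq_one hX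
    obtain ⟨t, ht⟩ := exists_eq_ratCast_smul_of_finrank_eq_one h1 hωrat hω0 (x := h) hh
    exact ⟨t, ht⟩

end Literature.AlgebraicGeometry.HodgeTheory

end
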